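import Summits.ResolutionOfSingularities.ResolutionOfSingularities.Theorems.PurelyInseparableDim4WideTangentCone
import Summits.ResolutionOfSingularities.ResolutionOfSingularities.Theorems.PurelyInseparableDim4JetLevelTwo
import Summits.ResolutionOfSingularities.ResolutionOfSingularities.Theorems.PurelyInseparableDim4NarrowTail
import HarnessLib

/-!
# [OURS · res-dim4-pi] AN INFINITE WIDE ISOLATED FLOOR CHAIN MAKES INFINITELY MANY TANGENT MOVES —
  the fat-point order `o ≥ 2` drops at every non-tangent move, so non-tangent runs are finite

Cell `res-dim4-pi` (D-0157 DOOR 2), seat `res-dim4-p-3` (g2); eighth file of the wide-core letter kit.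
The open core of F4-I(3,3) is `E2(3,3) = NoWideTrap 3 3` (p660329 / p662571): no infinite `Step0 p` chain
of isolated states of order `p` with ridge dimension `ē ≡ 2`.  p-9's FT / p-5's (Λ3) say such a chain
makes infinitely many SATELLITE moves (E-free runs are bounded by `μ⁺`).  This file adds the (NT) half
of idea-3's I-3-11 picture as a chain theorem: such a chain makes INFINITELY MANY TANGENT MOVES — moves
whose direction `e_j + b` is a zero of a non-zero degree-`o` tangent-cone form of the current fat point
(`…WideTangentCone.exists_tangentForm_laws` p666382): at every other move the order letter `o(c_k) ≥ 2`
drops strictly (`…WideNonTangent` (NT)(ii) p665399), which cannot go on for ever.  So the residual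
specimens of the wide core are exactly the TANGENT ∧ SATELLITE interplay (idea-3 P-3-9 / I-3-14 R*).

* `exists_order_of_wide` (the order letter `o ≥ 2` of a wide isolated floor state; bounded colength via
  p-1 g2's `jetColength_le_of_isCert`), **`order_step_lt_of_not_tangent`** (one edge), **`exists_tangent_move`** (chain form, `∇(in c₀) ≠ 0`),
  **`exists_tangent_move_succ`** (any chain: applied to the clean tail `k ≥ 1`).

[OURS · counted 0 · elementary; AI kernel work, weaker than expert review.]  Nothing here is a statement
about resolution of singularities; nothing here proves `NoWideTrap` / `E2(3,3)`; resolution in dimension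
`≥ 4` / characteristic `p > 0` is NOT proved by anything in this file.  Host item (DR-157-C):
`stmt-ResolutionOfSingularities-16155`, helper.
-/

noncomputable section

set_option linter.dupNamespace false -- mandated namespace of this single-conjunct summit

open MvPolynomial Finset
open scoped BigOperators

namespace Summit.ResolutionOfSingularities.ResolutionOfSingularities.Theorems.PIDim4.RidgeBudget

open IsolationCert
open Literature.AlgebraicGeometry
open Literature.AlgebraicGeometry.Resolution
open Literature.AlgebraicGeometry.Resolution.Hauser2010
open Literature.AlgebraicGeometry.Resolution.HauserPerlega2019
open Literature.Barriers.ResolutionOfSingularities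
open PointBlowup (direction gradSpan additiveSubspace boundarySubspace)

variable {K : Type} [Field K]

/-! ## §1 Bookkeeping: the order letter on a wide isolated floor state -/

/-- **The order letter of a wide isolated floor state**: at order exactly `p` with `ē = 2` and an
isolated point, there is `o ≥ 2` with `{k : d_k = k(k+1)/2} = {k ≤ o}`. OURS (glue: planarity p663672,
`exists_fatPointOrder` p666382, `d₂ = 1 + ē` p664584). [cite: AtiyahMacdonald1969, Prop. 6.9 (length is additive)] -/
theorem exists_order_of_wide (p : ℕ) [Fact p.Prime] {F : MvPolynomial (Fin 4) K} (hord : ordZero F = p)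
    (hwide : ebar F = 2) (hiso : IsIsolated p F) :
    ∃ o, 2 ≤ o ∧ ∀ k, jetColength p k F = k * (k + 1) / 2 ↔ k ≤ o := by
  have hp2 : 2 ≤ p := (Fact.out : p.Prime).two_le
  have he : Module.finrank K (additiveSubspace (initialForm F)) ≤ 2 := by
    unfold ebar at hwide; exact hwide.le
  obtain ⟨a, b, hab, hm⟩ := exists_originIdeal_le_span_pair_sup hp2 hord he
  obtain ⟨N, hN⟩ := exists_isCert_of_isIsolated hiso
  obtain ⟨o, ho⟩ := exists_fatPointOrder hab hm (B := jetColength p N F)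
    (fun k => jetColength_le_of_isCert hN k)
  refine ⟨o, (ho 2).mp ?_, ho⟩
  show jetColength p 2 F = 2 * (2 + 1) / 2
  rw [jetColength_two_eq hp2 hord he]
  unfold ebar at hwide
  rw [hwide]

/-! ## §2 One edge: a non-tangent move drops the order -/

/-- **ORDER DROP AT A NON-TANGENT MOVE (edge form).**  Let `s` be a wide isolated floor state (order `p`,
`∇ ≠ 0`, `ē = 2`) with order letter `o` (`{k : d_k(s) = k(k+1)/2} = {k ≤ o}`), and `s⁺` a successor with
order letter `o⁺`.  If the move is NOT tangent — i.e. it is not the case that some residual pair, order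
data and non-zero degree-`o` tangent form `g ∈ J_p⁺(s.F) + 𝔪₀^{o+1}` vanish at the direction of every
chart realisation of the move — then `o⁺ < o`. OURS ((NT)(ii) via `exists_tangentForm_laws`).
[cite: CossartJannsenSaito2020, Thm. 9.4] -/
theorem order_step_lt_of_not_tangent [DecidableEq K] (p : ℕ) [Fact p.Prime] [CharP K p]
    {s s' : State K} (hord : ordZero s.F = p) (hgrad : gradSpan (initialForm s.F) ≠ ⊥)
    (hwide : ebar s.F = 2)
    {o o' : ℕ} (ho : ∀ k, jetColength p k s.F = k * (k + 1) / 2 ↔ k ≤ o)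
    (ho' : ∀ k, jetColength p k s'.F = k * (k + 1) / 2 ↔ k ≤ o')
    (hnt : ¬ ∃ (a b : Fin 4) (n : ℕ) (g : MvPolynomial (Fin 4) K), a ≠ b ∧
      originIdeal K ≤ Ideal.span {(X a : MvPolynomial (Fin 4) K), X b} ⊔ singLocusIdeal p s.F ⊔
        originIdeal K ^ 2 ∧
      2 ≤ n ∧ jetColength p n s.F = n * (n + 1) / 2 ∧
      jetColength p (n + 1) s.F ≠ (n + 1) * (n + 1 + 1) / 2 ∧
      g ≠ 0 ∧ g.IsHomogeneous n ∧ g ∈ singLocusIdeal p s.F ⊔ originIdeal K ^ (n + 1) ∧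
      ∀ (j : Fin 4) (c : Fin 4 → K), c j = 0 → CentreBlowup.IsEquimultiplePoint p Finset.univ j c s →
        s' = CentreBlowup.step p Finset.univ j c s → eval (Function.update c j 1) g = 0) :
    o' < o := by
  have hp2 : 2 ≤ p := (Fact.out : p.Prime).two_le
  have he : Module.finrank K (additiveSubspace (initialForm s.F)) ≤ 2 := by
    unfold ebar at hwide; exact hwide.le
  obtain ⟨a, b, hab, hm⟩ := exists_originIdeal_le_span_pair_sup hp2 hord he
  -- `2 ≤ o`, `d_o = tri o`, `d_{o+1} ≠ tri (o+1)`
  have ho2 : 2 ≤ o := (ho 2).mp (by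
    show jetColength p 2 s.F = 2 * (2 + 1) / 2
    rw [jetColength_two_eq hp2 hord he]; unfold ebar at hwide; rw [hwide])
  have hoo : jetColength p o s.F = o * (o + 1) / 2 := (ho o).mpr le_rfl
  have hoo1 : jetColength p (o + 1) s.F ≠ (o + 1) * (o + 1 + 1) / 2 := fun h =>
    absurd ((ho (o + 1)).mp h) (by omega)
  obtain ⟨g, hg0, hhom, hgI, hlaws⟩ :=
    exists_tangentForm_laws p hord hgrad hwide.le hab hm ho2 hoo hoo1
  -- the move is not tangent for `g`: some chart realisation has `g(direction) ≠ 0`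
  have hreal : ∃ (j : Fin 4) (c : Fin 4 → K), c j = 0 ∧
      CentreBlowup.IsEquimultiplePoint p Finset.univ j c s ∧ s' = CentreBlowup.step p Finset.univ j c s ∧
      eval (Function.update c j 1) g ≠ 0 := by
    by_contra hall
    push Not at hall
    exact hnt ⟨a, b, o, g, hab, hm, ho2, hoo, hoo1, hg0, hhom, hgI, hall⟩
  obtain ⟨j, c, hcj, heq, hs', hev⟩ := hreal
  have hdrop := (hlaws j c hcj heq hev).1
  -- `o' < o`: otherwise `d_{o'}(s') = tri o'` contradicts the drop at level `o' ≥ o`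
  by_contra hle
  push Not at hle
  have h1 := hdrop o' hle
  rw [← hs'] at h1
  have h2 : jetColength p o' s'.F = o' * (o' + 1) / 2 := (ho' o').mpr le_rfl
  omega

/-! ## §3 Chain form: infinitely many tangent moves -/

/-- **AN INFINITE WIDE ISOLATED FLOOR CHAIN MAKES INFINITELY MANY TANGENT MOVES** (`∇(in c₀) ≠ 0`
form).  For a `Step0 p` chain of isolated states, all of order `p` with `ē = 2`: beyond every index there
is a TANGENT move `c k → c (k+1)` — a residual pair `(x_a, x_b)`, order data `o ≥ 2` and a non-zero
homogeneous tangent-cone form `g ∈ J_p⁺(c_k) + 𝔪₀^{o+1}` of degree `o` with `g(e_j + b) = 0` for every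
chart realisation `(j, b)` of the move.  (Otherwise the order letter would drop for ever.) OURS.
[cite: CossartJannsenSaito2020, Thm. 9.4] -/
theorem exists_tangent_move [DecidableEq K] (p : ℕ) [Fact p.Prime] [CharP K p] (c : ℕ → State K)
    (hc : ∀ k, Step0 p (c k) (c (k + 1))) (hiso : ∀ k, IsIsolated p (c k).F)
    (hord : ∀ k, ordZero (c k).F = p) (hwide : ∀ k, ebar (c k).F = 2)
    (hgrad : gradSpan (initialForm (c 0).F) ≠ ⊥) (k₀ : ℕ) :
    ∃ k, k₀ ≤ k ∧ ∃ (a b : Fin 4) (n : ℕ) (g : MvPolynomial (Fin 4) K), a ≠ b ∧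
      originIdeal K ≤ Ideal.span {(X a : MvPolynomial (Fin 4) K), X b} ⊔ singLocusIdeal p (c k).F ⊔
        originIdeal K ^ 2 ∧
      2 ≤ n ∧ jetColength p n (c k).F = n * (n + 1) / 2 ∧
      jetColength p (n + 1) (c k).F ≠ (n + 1) * (n + 1 + 1) / 2 ∧
      g ≠ 0 ∧ g.IsHomogeneous n ∧ g ∈ singLocusIdeal p (c k).F ⊔ originIdeal K ^ (n + 1) ∧
      ∀ (j : Fin 4) (b' : Fin 4 → K), b' j = 0 →
        CentreBlowup.IsEquimultiplePoint p Finset.univ j b' (c k) →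
        c (k + 1) = CentreBlowup.step p Finset.univ j b' (c k) → eval (Function.update b' j 1) g = 0 := by
  by_contra hnot
  push Not at hnot
  -- the order letter along the chain
  have hex : ∀ k, ∃ o, 2 ≤ o ∧ ∀ m, jetColength p m (c k).F = m * (m + 1) / 2 ↔ m ≤ o :=
    fun k => exists_order_of_wide p (hord k) (hwide k) (hiso k)
  choose o ho2 ho using hex
  have hgradk : ∀ k, gradSpan (initialForm (c k).F) ≠ ⊥ := fun k =>
    (Directrix.step0_chain_ordZero_eq p c hc (hord 0) hgrad k).2
  -- beyond `k₀` every move is non-tangent, so the order drops at every step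
  have key : ∀ k, k₀ ≤ k → o (k + 1) < o k := by
    intro k hk
    refine order_step_lt_of_not_tangent p (hord k) (hgradk k) (hwide k) (ho k) (ho (k + 1)) ?_
    rintro ⟨a, b, n, g, hab, hm, hn2, hn, hn1, hg0, hhom, hgI, hall⟩
    obtain ⟨j, b', hbj, heq, hck, hev⟩ := hnot k hk a b n g hab hm hn2 hn hn1 hg0 hhom hgI
    exact hev (hall j b' hbj heq hck)
  refine not_strictAnti_of_wellFoundedLT (fun m => o (k₀ + m)) (strictAnti_nat_of_succ_lt fun m => ?_)
  have := key (k₀ + m) (Nat.le_add_right k₀ m)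
  rwa [show k₀ + (m + 1) = k₀ + m + 1 by ring]

/-- **Any infinite wide isolated floor chain makes infinitely many tangent moves** (no `∇` hypothesis:
the tail `k ≥ 1` consists of cleaned states, `Directrix.isClean_step`, whose initial forms have
`∇ ≠ 0`). OURS. [cite: CossartJannsenSaito2020, Thm. 9.4] -/
theorem exists_tangent_move_succ [DecidableEq K] (p : ℕ) [Fact p.Prime] [CharP K p]
    (c : ℕ → State K) (hc : ∀ k, Step0 p (c k) (c (k + 1))) (hiso : ∀ k, IsIsolated p (c k).F)
    (hord : ∀ k, ordZero (c k).F = p) (hwide : ∀ k, ebar (c k).F = 2) (k₀ : ℕ) :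
    ∃ k, k₀ ≤ k ∧ ∃ (a b : Fin 4) (n : ℕ) (g : MvPolynomial (Fin 4) K), a ≠ b ∧
      originIdeal K ≤ Ideal.span {(X a : MvPolynomial (Fin 4) K), X b} ⊔
        singLocusIdeal p (c (k + 1)).F ⊔ originIdeal K ^ 2 ∧
      2 ≤ n ∧ jetColength p n (c (k + 1)).F = n * (n + 1) / 2 ∧
      jetColength p (n + 1) (c (k + 1)).F ≠ (n + 1) * (n + 1 + 1) / 2 ∧
      g ≠ 0 ∧ g.IsHomogeneous n ∧ g ∈ singLocusIdeal p (c (k + 1)).F ⊔ originIdeal K ^ (n + 1) ∧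
      ∀ (j : Fin 4) (b' : Fin 4 → K), b' j = 0 →
        CentreBlowup.IsEquimultiplePoint p Finset.univ j b' (c (k + 1)) →
        c (k + 1 + 1) = CentreBlowup.step p Finset.univ j b' (c (k + 1)) →
          eval (Function.update b' j 1) g = 0 := by
  -- the shifted chain `d k = c (k + 1)` starts at a cleaned state
  have hclean : HauserPerlega.IsClean p (c (0 + 1)).F := by
    obtain ⟨-, j, b, -, -, -, -, hck⟩ := hc 0
    rw [zero_add, hck]
    exact Directrix.isClean_step p _ j b (c 0)
  have hgrad1 : gradSpan (initialForm (c (0 + 1)).F) ≠ ⊥ :=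
    Directrix.gradSpan_initialForm_ne_bot_of_isClean p (hord (0 + 1)) hclean
  obtain ⟨k, hk, rest⟩ := exists_tangent_move p (fun k => c (k + 1)) (fun k => hc (k + 1))
    (fun k => hiso (k + 1)) (fun k => hord (k + 1)) (fun k => hwide (k + 1)) hgrad1 k₀
  exact ⟨k, hk, rest⟩

end Summit.ResolutionOfSingularities.ResolutionOfSingularities.Theorems.PIDim4.RidgeBudget

end
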